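import Summits.BirchSwinnertonDyer.BirchSwinnertonDyer.Theorems.AlignedTransportAtTwoMainConjectureOfRankZeroBSDAtTwoCyclotomicLayerLFunction
import HarnessLib

/-!
# Route `AlignedTransportAtTwo`, crux C2 `MainConjectureOfRankZeroBSDAtTwo` (stmt-BirchSwinnertonDyer-22298):
# THE JUMP BOUND — `rank E(K_{n+1}) − rank E(K_n) ≤ pⁿ(p−1)·c` with `Φ_{p^{n+1}}(1+T)^c ∣ char_Λ X`; over `ℚ` (Kato): the Mordell–Weil growth in the layer
# `ℚ_{n+1}/ℚ_n` is at most `φ(p^{n+1})` times the ORDER OF VANISHING of `L_p(E,T)` at the characters of order `p^{n+1}`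

HONEST FRAMING (cell `bsd-f1-sign2`, WIDTH-5 attached prover seat `bsd-line-att-p5` gen 36 on line `birth` of the lead `bsd-line-att-p2`;
`--supports` stmt-BirchSwinnertonDyer-22298, closes nothing; BSD is NOT proved by any of this; the crux C2, its verdict «blocked-on
`Rank1Residual.GreenbergMuConjectureIrreducible`» and every registered stub are untouched). THEOREMS ONLY — no `def`, no named fact, no `sorry`; the one print
binder in §2 is the lineage's `h17 : kato_divisibility_allPrimes W p` (Kato 17.4 (1)(2)). Quantitative form of this gen's layer dichotomy
(`…CyclotomicLayerRankDichotomy`): the kernel lattice `A_n` of the relative norm has `rank_ℤ A_n = pⁿ(p−1)·c` (§1 of the dichotomy file), its points feed the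
core of the layer theorem with `t = c` (`Φ_{p^{n+1}}(1+T)^c ∣ f`), and rank–nullity gives `rank E(K_{n+1}) ≤ rank E(K_n) + rank A_n`. No representation theory
beyond `pⁿ(p−1) ∣ rank A_n`; the reverse inequality (the jump is EXACTLY `pⁿ(p−1)·c'` for some `c' ≤ c`) is not needed and not proved.

* §1 ★★★ `exists_cyclotomicLayer_pow_dvd_and_mordellWeilRank_le` — **for `E/K` elliptic over a number field, ANY `ℤ_p`-extension with topological generator `γ`,
  any dual datum with `X` finitely generated and torsion, `f ∈ char_Λ X`, every `n`: `∃ c, Φ_{p^{n+1}}(1+T)^c ∣ f ∧ rank E(K_{n+1}) ≤ rank E(K_n) + pⁿ(p−1)·c`**;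
  hence `mordellWeilRank_layer_succ_le_add_of_not_pow_dvd` — **`Φ_{p^{n+1}}(1+T)^{c+1} ∤ f ⇒ rank E(K_{n+1}) ≤ rank E(K_n) + pⁿ(p−1)·c`** (the jump is at most `φ(p^{n+1})`
  times the multiplicity of the layer prime in `char X` — the kernel form of the `Φ_n^{e_n}` bookkeeping of Kurihara–Pollack §3.1, inequality direction).
* §2 `W/ℚ`, good ordinary `p`, PRINT `h17`: ★★ `exists_cyclotomicLayer_pow_dvd_lift_and_mordellWeilRank_le` — **`∃ c, Φ_{p^{n+1}}(1+T)^c ∣ G ∧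
  rank W(ℚ_{n+1}) ≤ rank W(ℚ_n) + pⁿ(p−1)·c`** for every integral lift `G` of `L_p(f,α)`: THE GROWTH IN `ℚ_{n+1}/ℚ_n` IS AT MOST `φ(p^{n+1})` TIMES THE ORDER OF
  VANISHING OF THE `p`-ADIC `L`-FUNCTION AT THE CHARACTERS OF ORDER `p^{n+1}` — the layer-by-layer form of Kato's «`rank ≤ ord L_p`»
  (`mordellWeilRank_layer_succ_le_add_of_not_pow_dvd_lift`); on the `a₂ = +1` road (cofactor prime) every jump above `ℚ₁` is `≤ 2ⁿ`
  (`mordellWeilRank_layer_succ_le_add_two_pow_of_sq_not_dvd`, from `Φ² ∤ G`).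

References: K. Kato, Astérisque 295 (2004), Thm. 17.4, Thm. 18.4 [Kato2004Asterisque]; R. Greenberg, LNM 1716 (1999), Thm. 1.9, §5 p. 132 [GreenbergLNM1716];
M. Kurihara, R. Pollack (2007), §3.1 [KuriharaPollack2007].
-/

set_option linter.dupNamespace false
set_option autoImplicit false

noncomputable section

open scoped Classical Polynomial MatrixGroups ModularForm

namespace Summit.BirchSwinnertonDyer.BirchSwinnertonDyer.Theorems.AlignedTransportAtTwoCyclotomicLayerRankJumpBound

open Polynomial WeierstrassCurve Literature.NumberTheory.EllipticCurves
  Summit.BirchSwinnertonDyer.Rank1Residual.X1.MuLambda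
  Summit.BirchSwinnertonDyer.Rank1Residual.Iwasawa
  Summit.BirchSwinnertonDyer.BirchSwinnertonDyer.Theorems.AlignedTransportAtTwoCyclotomicLayerNorm
  Summit.BirchSwinnertonDyer.BirchSwinnertonDyer.Theorems.AlignedTransportAtTwoCyclotomicLayerRankGrowth
  Summit.BirchSwinnertonDyer.BirchSwinnertonDyer.Theorems.AlignedTransportAtTwoCyclotomicLayerRankDichotomy
  Summit.BirchSwinnertonDyer.BirchSwinnertonDyer.Theorems.AlignedTransportAtTwoCyclotomicLayerLFunction

universe u

/-! ## §1 The quantitative dichotomy -/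

section Jump

variable {K : Type u} [Field K] [NumberField K] (W : WeierstrassCurve K) [W.IsElliptic] {p : ℕ} [hp : Fact p.Prime]
  {κ : ZpExtension K p} {γ : Field.absoluteGaloisGroup K}

/-- ★★★ **THE JUMP BOUND** (with the divisibility of `E(K̄)` as hypothesis `hdiv`, discharged below): for `E/K` elliptic over a number field, ANY `ℤ_p`-extension `κ`
with topological generator `γ`, a dual datum with `X` finitely generated and torsion, `f ∈ char_Λ X` and every `n`:
**`∃ c, Φ_{p^{n+1}}(1+T)^c ∣ f ∧ rank E(K_{n+1}) ≤ rank E(K_n) + pⁿ(p−1)·c`.** PROOF: `A_n = ker` of the relative norm `N_n`; `γ` preserves `A_n` with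
`Φ_{p^{n+1}}(γ)|_{A_n} = 0`, so `rank_ℤ A_n = pⁿ(p−1)·c` (`totient_dvd_finrank_of_aeval_cyclotomic_eq_zero`); its `rank A_n` independent points with dual functionals
feed the core of the layer theorem with `t = c`; rank–nullity `rank E(K_{n+1}) = rank N_n(E(K_{n+1})) + rank A_n ≤ rank E(K_n) + rank A_n`.
[cite: GreenbergLNM1716, §5 p. 132 and Thm. 1.9 (p. 63)] -/
theorem exists_cyclotomicLayer_pow_dvd_and_mordellWeilRank_le_of (hdiv : W.zsmul_geomPoints_surjective)
    (hγ : κ.IsTopGenerator γ) (D : W.SelmerDualData κ γ) [Module.Finite (IwasawaAlgebra p) D.X]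
    (hD : D.IsTorsion) {f : IwasawaAlgebra p} (hf : f ∈ D.charIdeal) (n : ℕ) :
    ∃ c : ℕ, (((cyclotomic (p ^ (n + 1)) ℤ_[p]).comp (X + 1) : ℤ_[p][X]) : PowerSeries ℤ_[p]) ^ c ∣ f ∧
      (W.baseChange (κ.layer (n + 1))).mordellWeilRank ≤ (W.baseChange (κ.layer n)).mordellWeilRank + p ^ n * (p - 1) * c := by
  letI : ∀ m, DecidableEq (κ.layer m) := fun m a b ↦ Classical.propDecidable (a = b)
  haveI : FiniteDimensional K (κ.layer (n + 1)) := κ.finiteDimensional_layer_holds (n + 1)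
  haveI : NumberField (κ.layer (n + 1)) := NumberField.of_module_finite K (κ.layer (n + 1))
  haveI : FiniteDimensional K (κ.layer n) := κ.finiteDimensional_layer_holds n
  haveI : NumberField (κ.layer n) := NumberField.of_module_finite K (κ.layer n)
  haveI := (W.baseChange (κ.layer (n + 1))).module_finite_point_holds
  haveI := (W.baseChange (κ.layer n)).module_finite_point_holds
  -- the relative norm and its kernel lattice (as in the dichotomy file)
  let Nend : geomPoints W →+ geomPoints W :=
    { toFun := fun Q ↦ ∑ j ∈ Finset.range p, γ ^ (p ^ n * j) • Q
      map_zero' := by simp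
      map_add' := fun Q Q' ↦ by simp [Finset.sum_add_distrib] }
  let N := Nend.comp (layerPointsMap W κ (n + 1))
  have hN : ∀ P, N P = ∑ j ∈ Finset.range p, γ ^ (p ^ n * j) • layerPointsMap W κ (n + 1) P := fun _ ↦ rfl
  set φ := N.toIntLinearMap with hφ
  let A := LinearMap.ker φ
  have hmemA : ∀ {P}, P ∈ A ↔ ∑ j ∈ Finset.range p, γ ^ (p ^ n * j) • layerPointsMap W κ (n + 1) P = 0 := fun {P} ↦ by
    rw [LinearMap.mem_ker]; exact Iff.rfl
  let g := (layerGal W κ (n + 1) γ).toIntLinearMap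
  have hgA : ∀ P ∈ A, g P ∈ A := by
    intro P hP
    rw [hmemA] at hP ⊢
    change ∑ j ∈ Finset.range p, γ ^ (p ^ n * j) • layerPointsMap W κ (n + 1) (layerGal W κ (n + 1) γ P) = 0
    simp_rw [layerPointsMap_layerGal, smul_smul, ← pow_succ, pow_succ', mul_smul, ← Finset.smul_sum, hP, smul_zero]
  let gA : Module.End ℤ A := g.restrict hgA
  have hpow : ∀ (k : ℕ) (a : A), ((gA ^ k) a : (W.baseChange (κ.layer (n + 1))).toAffine.Point) = (layerGal W κ (n + 1) γ)^[k] a := by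
    intro k a
    induction k with
    | zero => rfl
    | succ k ih => rw [pow_succ', Module.End.mul_apply, Function.iterate_succ_apply', ← ih]; rfl
  have haeval : Polynomial.aeval gA (cyclotomic (p ^ (n + 1)) ℤ) = 0 := by
    ext a
    rw [cyclotomic_prime_pow_eq_geom_sum hp.out, map_sum, LinearMap.coe_sum, Finset.sum_apply, LinearMap.zero_apply,
      Submodule.coe_zero, AddSubmonoidClass.coe_finsetSum]
    simp_rw [← pow_mul, map_pow, Polynomial.aeval_X, hpow, layerGal_iterate_apply, pow_mul, ← layerGal_iterate_apply]
    exact sum_layerGal_iterate_eq_zero_of_relNorm_eq_zero W κ γ n (hmemA.mp a.2)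
  have hdvdA : p ^ n * (p - 1) ∣ Module.finrank ℤ A := by
    have h := totient_dvd_finrank_of_aeval_cyclotomic_eq_zero gA (pow_pos hp.out.pos (n + 1)) haeval
    rwa [Nat.totient_prime_pow_succ hp.out] at h
  obtain ⟨c, hc⟩ := hdvdA
  -- rank–nullity
  have h1 := Submodule.finrank_quotient_add_finrank (LinearMap.ker φ)
  rw [φ.quotKerEquivRange.finrank_eq] at h1
  have h2 : Module.finrank ℤ (LinearMap.range φ) ≤ (W.baseChange (κ.layer n)).mordellWeilRank := by
    have hle : LinearMap.range φ ≤ LinearMap.range (layerPointsMap W κ n).toIntLinearMap := by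
      rintro _ ⟨P, rfl⟩
      obtain ⟨Q, hQ⟩ := exists_layerPoints_eq_relNorm W κ n hγ P
      exact ⟨Q, hQ.trans (hN P).symm⟩
    unfold WeierstrassCurve.mordellWeilRank
    rw [← LinearMap.finrank_range_of_inj (f := (layerPointsMap W κ n).toIntLinearMap) (layerPointsMap_injective W κ n)]
    exact Submodule.finrank_mono hle
  refine ⟨c, ?_, ?_⟩
  · obtain ⟨P, lam, N₀, hN₀, hPA, hlam⟩ := exists_points_functionals_of_le A
    exact cyclotomicLayer_pow_dvd_of_mem_charIdeal_of_points_functionals W hdiv hγ D hD hf n (le_of_eq hc.symm) P lam N₀ hN₀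
      (fun i ↦ sum_layerGal_iterate_eq_zero_of_relNorm_eq_zero W κ γ n (hmemA.mp (hPA i))) hlam
  · unfold WeierstrassCurve.mordellWeilRank at h2 ⊢
    change Module.finrank ℤ _ + Module.finrank ℤ A = Module.finrank ℤ _ at h1
    rw [← hc]
    omega

/-- ★★★ **THE JUMP BOUND, UNCONDITIONALLY**: `∃ c, Φ_{p^{n+1}}(1+T)^c ∣ f ∧ rank_ℤ E(K_{n+1}) ≤ rank_ℤ E(K_n) + pⁿ(p−1)·c` for every `f ∈ char_Λ X(E/K_∞)`, every layer `n`,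
every `ℤ_p`-extension of every number field (dual datum with `X` finitely generated and torsion). [cite: GreenbergLNM1716, §5 p. 132 and Thm. 1.9 (p. 63)] -/
theorem exists_cyclotomicLayer_pow_dvd_and_mordellWeilRank_le (hγ : κ.IsTopGenerator γ) (D : W.SelmerDualData κ γ)
    [Module.Finite (IwasawaAlgebra p) D.X] (hD : D.IsTorsion) {f : IwasawaAlgebra p} (hf : f ∈ D.charIdeal) (n : ℕ) :
    ∃ c : ℕ, (((cyclotomic (p ^ (n + 1)) ℤ_[p]).comp (X + 1) : ℤ_[p][X]) : PowerSeries ℤ_[p]) ^ c ∣ f ∧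
      (W.baseChange (κ.layer (n + 1))).mordellWeilRank ≤ (W.baseChange (κ.layer n)).mordellWeilRank + p ^ n * (p - 1) * c :=
  exists_cyclotomicLayer_pow_dvd_and_mordellWeilRank_le_of W W.zsmul_geomPoints_surjective_holds hγ D hD hf n

/-- **The jump is at most `φ(p^{n+1})` times the multiplicity of the layer prime in `char X`**: `Φ_{p^{n+1}}(1+T)^{c+1} ∤ f ⇒ rank E(K_{n+1}) ≤ rank E(K_n) + pⁿ(p−1)·c`.
[cite: GreenbergLNM1716, §5 p. 132] [cite: KuriharaPollack2007, §3.1] -/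
theorem mordellWeilRank_layer_succ_le_add_of_not_pow_dvd (hγ : κ.IsTopGenerator γ) (D : W.SelmerDualData κ γ)
    [Module.Finite (IwasawaAlgebra p) D.X] (hD : D.IsTorsion) {f : IwasawaAlgebra p} (hf : f ∈ D.charIdeal) (n : ℕ) {c : ℕ}
    (hc : ¬ (((cyclotomic (p ^ (n + 1)) ℤ_[p]).comp (X + 1) : ℤ_[p][X]) : PowerSeries ℤ_[p]) ^ (c + 1) ∣ f) :
    (W.baseChange (κ.layer (n + 1))).mordellWeilRank ≤ (W.baseChange (κ.layer n)).mordellWeilRank + p ^ n * (p - 1) * c := by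
  obtain ⟨c', hdvd, hle⟩ := exists_cyclotomicLayer_pow_dvd_and_mordellWeilRank_le W hγ D hD hf n
  have hc' : c' ≤ c := by
    by_contra hlt
    exact hc (dvd_trans (pow_dvd_pow _ (by omega)) hdvd)
  exact hle.trans (Nat.add_le_add_left (Nat.mul_le_mul_left _ hc') _)

end Jump

/-! ## §2 Over `ℚ` (Kato): the growth in `ℚ_{n+1}/ℚ_n` is at most `φ(p^{n+1})` times the order of vanishing of `L_p` at the characters of order `p^{n+1}` -/

section Analytic

open PowerSeries CongruenceSubgroup Literature.NumberTheory.EllipticCurves.ModularForms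
  Literature.NumberTheory.EllipticCurves.Rank1Residual Literature.NumberTheory.EllipticCurves.Greenberg1999
  Summit.BirchSwinnertonDyer.Rank1Residual
  Summit.BirchSwinnertonDyer.BirchSwinnertonDyer.Theorems.DefectPrime

variable (W : WeierstrassCurve ℚ) [W.IsElliptic] [W.IsGloballyMinimal] {p : ℕ} [hp : Fact p.Prime]

/-- ★★ **KATO'S `rank ≤ ord L_p`, LAYER BY LAYER.** `W/ℚ` globally minimal, good ordinary at `p`, `f` a newform of `W` with PRINT `h17` (Kato 17.4 (1)(2)), `G ∈ Λ` an integral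
lift of `L_p(f,α)`, `κ` the cyclotomic `ℤ_p`-extension with normalised topological generator `γ`. For every `n`:
**`∃ c, Φ_{p^{n+1}}(1+T)^c ∣ G ∧ rank W(ℚ_{n+1}) ≤ rank W(ℚ_n) + pⁿ(p−1)·c`** — the Mordell–Weil growth in the layer `ℚ_{n+1}/ℚ_n` is at most `φ(p^{n+1})` times the
order of vanishing of the `p`-adic `L`-function at the characters of exact order `p^{n+1}`. [cite: Kato2004Asterisque, Thm. 17.4 (1)(2) (p. 273) and Thm. 18.4 (p. 281)]
[cite: GreenbergLNM1716, §5 p. 132] -/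
theorem exists_cyclotomicLayer_pow_dvd_lift_and_mordellWeilRank_le {N : ℕ} [NeZero N] {f : CuspForm (Gamma0 N) 2}
    (h17 : kato_divisibility_allPrimes W p (f := f)) (hord : IsOrdinaryAt W p) (hf : IsNewformOf W f)
    {G : IwasawaAlgebra p} (hG : iwasawaToPowerSeries p G = padicLFunction f (unitRoot W p : ℚ_[p]))
    {κ : ZpExtension ℚ p} {γ : Field.absoluteGaloisGroup ℚ} (hκ : κ.IsCyclotomic) (hγ : κ.IsTopGenerator γ)
    (hγ' : IsCyclotomicVariable p γ) (n : ℕ) :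
    ∃ c : ℕ, (((cyclotomic (p ^ (n + 1)) ℤ_[p]).comp (Polynomial.X + 1) : ℤ_[p][X]) : PowerSeries ℤ_[p]) ^ c ∣ G ∧
      (W.baseChange (κ.layer (n + 1))).mordellWeilRank ≤ (W.baseChange (κ.layer n)).mordellWeilRank + p ^ n * (p - 1) * c := by
  obtain ⟨D⟩ := W.nonempty_selmerDualData_holds κ γ hγ
  haveI : Module.Finite (IwasawaAlgebra p) D.X := D.module_finite_holds hγ
  haveI : (Module.charIdeal (IwasawaAlgebra p) D.X).IsPrincipal := charIdeal_isPrincipal_holds p D.X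
  obtain ⟨fX, hfX⟩ := Submodule.IsPrincipal.principal (Module.charIdeal (IwasawaAlgebra p) D.X)
  have hchar : D.charIdeal = Ideal.span {fX} := hfX
  obtain ⟨hD, a, m, hrel⟩ := isTorsion_and_exists_charGen_mul_eq_C_pow_mul_of_kato W h17 hκ hγ hγ' hord hf D hchar hG
  obtain ⟨c, hdvd, hle⟩ := exists_cyclotomicLayer_pow_dvd_and_mordellWeilRank_le W hγ D hD (hchar ▸ Ideal.mem_span_singleton_self fX) n
  exact ⟨c, cyclotomicLayer_pow_dvd_of_dvd_C_mul n c m (G := G) (by rw [← hrel]; exact dvd_mul_of_dvd_left hdvd a), hle⟩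

/-- **`Φ_{p^{n+1}}(1+T)^{c+1} ∤ L_p ⇒ rank W(ℚ_{n+1}) ≤ rank W(ℚ_n) + pⁿ(p−1)·c`** (growth bounded by `φ(p^{n+1}) ·` the order of vanishing at the layer's characters).
[cite: Kato2004Asterisque, Thm. 17.4 (1)(2) (p. 273)] -/
theorem mordellWeilRank_layer_succ_le_add_of_not_pow_dvd_lift {N : ℕ} [NeZero N] {f : CuspForm (Gamma0 N) 2}
    (h17 : kato_divisibility_allPrimes W p (f := f)) (hord : IsOrdinaryAt W p) (hf : IsNewformOf W f)
    {G : IwasawaAlgebra p} (hG : iwasawaToPowerSeries p G = padicLFunction f (unitRoot W p : ℚ_[p]))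
    {κ : ZpExtension ℚ p} {γ : Field.absoluteGaloisGroup ℚ} (hκ : κ.IsCyclotomic) (hγ : κ.IsTopGenerator γ)
    (hγ' : IsCyclotomicVariable p γ) (n : ℕ) {c : ℕ}
    (hc : ¬ (((cyclotomic (p ^ (n + 1)) ℤ_[p]).comp (Polynomial.X + 1) : ℤ_[p][X]) : PowerSeries ℤ_[p]) ^ (c + 1) ∣ G) :
    (W.baseChange (κ.layer (n + 1))).mordellWeilRank ≤ (W.baseChange (κ.layer n)).mordellWeilRank + p ^ n * (p - 1) * c := by
  obtain ⟨c', hdvd, hle⟩ := exists_cyclotomicLayer_pow_dvd_lift_and_mordellWeilRank_le W h17 hord hf hG hκ hγ hγ' n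
  have hc' : c' ≤ c := by
    by_contra hlt
    exact hc (dvd_trans (pow_dvd_pow _ (by omega)) hdvd)
  exact hle.trans (Nat.add_le_add_left (Nat.mul_le_mul_left _ hc') _)

/-- **A jump by MORE than `pⁿ(p−1)·c` forces vanishing order `≥ c + 1`**: `rank W(ℚ_n) + pⁿ(p−1)·c < rank W(ℚ_{n+1}) ⇒ Φ_{p^{n+1}}(1+T)^{c+1} ∣ G`.
[cite: Kato2004Asterisque, Thm. 17.4 (1)(2) (p. 273)] -/
theorem cyclotomicLayer_pow_succ_dvd_lift_of_lt {N : ℕ} [NeZero N] {f : CuspForm (Gamma0 N) 2}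
    (h17 : kato_divisibility_allPrimes W p (f := f)) (hord : IsOrdinaryAt W p) (hf : IsNewformOf W f)
    {G : IwasawaAlgebra p} (hG : iwasawaToPowerSeries p G = padicLFunction f (unitRoot W p : ℚ_[p]))
    {κ : ZpExtension ℚ p} {γ : Field.absoluteGaloisGroup ℚ} (hκ : κ.IsCyclotomic) (hγ : κ.IsTopGenerator γ)
    (hγ' : IsCyclotomicVariable p γ) (n : ℕ) {c : ℕ}
    (hlt : (W.baseChange (κ.layer n)).mordellWeilRank + p ^ n * (p - 1) * c < (W.baseChange (κ.layer (n + 1))).mordellWeilRank) :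
    (((cyclotomic (p ^ (n + 1)) ℤ_[p]).comp (Polynomial.X + 1) : ℤ_[p][X]) : PowerSeries ℤ_[p]) ^ (c + 1) ∣ G := by
  by_contra hc
  have h := mordellWeilRank_layer_succ_le_add_of_not_pow_dvd_lift W h17 hord hf hG hκ hγ hγ' n hc
  omega

end Analytic

end Summit.BirchSwinnertonDyer.BirchSwinnertonDyer.Theorems.AlignedTransportAtTwoCyclotomicLayerRankJumpBound
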